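import Summits.ResolutionOfSingularities.ResolutionOfSingularities.Theorems.HomologicalConductorNoZenoRQuadraticTransformTermination
import Summits.ResolutionOfSingularities.ResolutionOfSingularities.Theorems.HomologicalConductorNoZenoRMinimalResolutionGlobal
import Literature.AlgebraicGeometry.Resolution.BirationalLocalIso
import Literature.AlgebraicGeometry.Resolution.NormalAscent
import Literature.AlgebraicGeometry.Resolution.BlowupsProperProofs
import Literature.AlgebraicGeometry.Resolution.PermissibleCentres
import Literature.AlgebraicGeometry.Resolution.AlterationsMultisectionLocalStep
import HarnessLib

/-!
# Crux `NoZenoR` (stmt-ResolutionOfSingularities-19943) — the blowing up of a normal stage at a non-regular point has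
# a POSITIVE-DIMENSIONAL fibre (Zariski's Main Theorem), so each step of Lipman's (4.1) process raises the curve count

Route `ResolutionOfSingularities/HomologicalConductor` (cell decomp-res, hand leafhand-res-homologicalconduct-21 g0).
OURS: AI-written proof over tree theorems, weaker than expert review; nothing here is a statement of the manuscript
under review (Hironaka 2017).  SUPPORT level, counted 0.  Def-free, FACT-FREE.

Companion of `…NoZenoRQuadraticTransformTermination` (`ncard_excCurvePoints_lt_of_step` needs a NON-closed point in
the fibre of the step over a closed point).  For the step of Lipman's process — the blowing up `b : W₂ → W` of a NORMAL
integral Noetherian `W` at a closed point `w` whose local ring is not regular (e.g. a non-regular normal point of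
dimension two) — such a point exists:

* `finite_of_forall_isClosed_singleton` — a closed subset of a Noetherian scheme all of whose points are closed points
  is finite;
* **`exists_not_isClosed_of_isBlowup_vanishingIdeal`** — if every point of `b⁻¹(w)` were closed, the fibre would be
  finite, so (Zariski's Main Theorem over the normal `W`, tree `exists_isIso_morphismRestrict_of_finite_preimage_singleton`)
  `b` would be an isomorphism over a neighbourhood of `w`; but `𝓘_w·𝒪_{W₂}` is invertible (`IsBlowup`), so `𝔪_w` would
  be principal (stalks transported along the isomorphic local rings, `GlobalResolution.isPrincipal_stalkIdeal_of_comap_of_isIso_stalkMap`)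
  and `𝒪_{W,w}` regular (`isRegularLocalRing_of_maximalIdeal_isPrincipal`) — contradiction;
* **`ncard_excCurvePoints_lt_of_pointBlowup_of_stage`** — hence, for stages under a fixed desingularization
  `π : X → Spec S` of a two-dimensional Noetherian local domain, the point blow-up step strictly raises
  `#excCurvePoints`, which is bounded by `#excCurvePoints π` (`finite_and_ncard_excCurvePoints_stage_le`): Lipman's process
  «blow up a non-regular point of the (normal) stage» stops after at most `#excCurvePoints π` steps.

What is NOT here: Prop. (8.1) (normality of the stages).  No crux, kill test or summit statement is proved here;
resolution in positive characteristic is NOT proved.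

References: J. Lipman, Publ. Math. IHÉS 36 (1969), Theorem (4.1), proof (p. 204) [`Lipman1969`]; The Stacks Project,
Tag 02LQ (Zariski's Main Theorem) [`StacksProject`].
-/

noncomputable section

-- single-problem summit: the doubled namespace component `ResolutionOfSingularities` is forced
set_option linter.dupNamespace false

open CategoryTheory CategoryTheory.Limits AlgebraicGeometry TopologicalSpace Topology IsLocalRing
open Literature.AlgebraicGeometry.Resolution

namespace Summit.ResolutionOfSingularities.ResolutionOfSingularities.Theorems.NoZeno.QuadraticTransform

/-- **A closed subset of a Noetherian scheme all of whose points are closed points is finite** (its points have height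
`0`, so it has dimension `≤ 0`). [folklore] -/
theorem finite_of_forall_isClosed_singleton {Y : Scheme.{0}} [IsNoetherian Y] {Z : Set Y} (hZ : IsClosed Z)
    (h : ∀ y ∈ Z, IsClosed ({y} : Set Y)) : Z.Finite := by
  have h0 : topologicalKrullDim Z ≤ 0 := by
    have := topologicalKrullDim_le_of_forall_height_le hZ 0 fun y hy => by
      rw [Scheme.height_of_isClosed (h y hy)]
      exact le_rfl
    exact_mod_cast this
  exact set_finite_of_topologicalKrullDim_le_zero Z h0

/-- **`𝓘_w ≠ 0` at a non-regular point**: otherwise `W = {w}` and `𝒪_{W,w}` is the function field, a regular ring.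
[folklore] -/
theorem vanishingIdeal_ne_bot_of_not_isRegularLocalRing {W : Scheme.{0}} [IsIntegral W] {w : W}
    (hwc : IsClosed ({w} : Set W)) (hwsing : ¬ IsRegularLocalRing (W.presheaf.stalk w)) :
    Scheme.IdealSheafData.vanishingIdeal ⟨{w}, hwc⟩ ≠ ⊥ := by
  intro h
  have hsupp : (((Scheme.IdealSheafData.vanishingIdeal (X := W) ⟨{w}, hwc⟩).support : Set W)) = Set.univ := by
    rw [h, Scheme.IdealSheafData.support_bot]; rfl
  rw [Scheme.IdealSheafData.coe_support_vanishingIdeal] at hsupp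
  have hgen : genericPoint W ∈ ((⟨{w}, hwc⟩ : Closeds W) : Set W) := by rw [hsupp]; trivial
  change genericPoint W ∈ ({w} : Set W) at hgen
  rw [Set.mem_singleton_iff] at hgen
  apply hwsing
  rw [← hgen]
  have hF : IsField (W.presheaf.stalk (genericPoint W)) := Field.toIsField W.functionField
  refine isRegularLocalRing_of_maximalIdeal_isPrincipal ⟨⟨0, ?_⟩⟩
  rw [(IsLocalRing.isField_iff_maximalIdeal_eq).mp hF]
  simp

/-- **The blowing up of a normal scheme at a non-regular closed point has a non-closed point in its fibre.**  `W`
integral Noetherian with integrally closed local rings, `w` a closed point with `𝒪_{W,w}` NOT regular, `b : W₂ → W` a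
blowing up along the ideal sheaf `𝓘_w` of the reduced point: some `ζ ∈ b⁻¹(w)` is not a closed point of `W₂`.
[cite: Lipman1969, Theorem (4.1), proof (p. 204)] [cite: StacksProject, Tag 02LQ] -/
theorem exists_not_isClosed_of_isBlowup_vanishingIdeal {W W₂ : Scheme.{0}} [IsIntegral W] [IsNoetherian W]
    (hWn : ∀ y : W, IsIntegrallyClosed (W.presheaf.stalk y)) {w : W} (hwc : IsClosed ({w} : Set W))
    (hwsing : ¬ IsRegularLocalRing (W.presheaf.stalk w)) {b : W₂ ⟶ W}
    (hb : IsBlowup b (Scheme.IdealSheafData.vanishingIdeal ⟨{w}, hwc⟩)) :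
    ∃ ζ : W₂, b ζ = w ∧ ¬ IsClosed ({ζ} : Set W₂) := by
  set I : W.IdealSheafData := Scheme.IdealSheafData.vanishingIdeal ⟨{w}, hwc⟩ with hI
  have hI0 : I ≠ ⊥ := vanishingIdeal_ne_bot_of_not_isRegularLocalRing hwc hwsing
  haveI : IsProper b := hb.isProper
  haveI : IsIntegral W₂ := hb.isIntegral hI0
  have hbir : IsBirational b := hb.isBirational' hI0
  haveI : IsDominant b := hbir.isDominant
  haveI : IsNoetherian W₂ := by
    haveI : IsLocallyNoetherian W₂ := LocallyOfFiniteType.isLocallyNoetherian b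
    haveI : CompactSpace W₂ := QuasiCompact.compactSpace_of_compactSpace b
    exact {}
  by_contra hall
  push Not at hall
  -- the fibre is a finite set of closed points
  have hfin : (b.base ⁻¹' {w}).Finite :=
    finite_of_forall_isClosed_singleton (hwc.preimage b.continuous) fun y hy => hall y hy
  -- Zariski: `b` is an isomorphism over a neighbourhood `V ∋ w`
  obtain ⟨V, hwV, hV⟩ := exists_isIso_morphismRestrict_of_finite_preimage_singleton b hbir ⊤ (fun y _ => hWn y)
    (Opens.mem_top w) hfin
  haveI := hV
  -- a point of `W₂` over `w`, with isomorphic local ring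
  obtain ⟨y₂, hy₂⟩ := ExcCount.surjective_of_isProper_of_isDominant b w
  haveI := isIso_stalkMap_of_isIso_morphismRestrict b V y₂ (by rw [hy₂]; exact hwV)
  -- `𝔪_w = (𝓘_w)_w` is principal: `𝓘_w·𝒪_{W₂}` is invertible and the local rings agree
  have hprin : (stalkIdeal I (b y₂)).IsPrincipal :=
    GlobalResolution.isPrincipal_stalkIdeal_of_comap_of_isIso_stalkMap b I y₂
      (hb.isEffectiveCartier.isLocallyPrincipal y₂).isPrincipal_stalkIdeal
  rw [hy₂, hI, stalkIdeal_vanishingIdeal_singleton hwc] at hprin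
  exact hwsing (isRegularLocalRing_of_maximalIdeal_isPrincipal hprin)

/-- **The point blow-up step of Lipman's process strictly raises the curve count.**  `S` a two-dimensional Noetherian
local domain, `π : X → Spec S` a desingularization; `g : W → Spec S` a NORMAL stage (`W` integral Noetherian with
integrally closed local rings), `w` a closed point of `W` over the closed point with `𝒪_{W,w}` not regular,
`b : W₂ → W` a blowing up of the point `w`, and `σ₂ : X → W₂` a resolution with `σ₂ ≫ b ≫ g = π`.  Then
`#excCurvePoints g < #excCurvePoints (b ≫ g) ≤ #excCurvePoints π`. [cite: Lipman1969, Theorem (4.1), proof (p. 204)] -/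
theorem ncard_excCurvePoints_lt_of_pointBlowup_of_stage {S : Type} [CommRing S] [IsNoetherianRing S] [IsLocalRing S]
    [IsDomain S] (h2 : ringKrullDim S = 2) {X W W₂ : Scheme.{0}} (π : X ⟶ Spec (.of S)) (hπ : IsResolution π)
    [IsIntegral W] [IsNoetherian W] (g : W ⟶ Spec (.of S)) (hWn : ∀ y : W, IsIntegrallyClosed (W.presheaf.stalk y))
    {w : W} (hwc : IsClosed ({w} : Set W)) (hgw : g w = closedPoint S)
    (hwsing : ¬ IsRegularLocalRing (W.presheaf.stalk w)) {b : W₂ ⟶ W}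
    (hb : IsBlowup b (Scheme.IdealSheafData.vanishingIdeal ⟨{w}, hwc⟩)) (σ₂ : X ⟶ W₂) (hσ₂ : IsResolution σ₂)
    (hfac : σ₂ ≫ b ≫ g = π) :
    (excCurvePoints g).ncard < (excCurvePoints (b ≫ g)).ncard ∧
      (excCurvePoints (b ≫ g)).ncard ≤ (excCurvePoints π).ncard := by
  obtain ⟨ζ, hζw, hζ⟩ := exists_not_isClosed_of_isBlowup_vanishingIdeal hWn hwc hwsing hb
  have hI0 := vanishingIdeal_ne_bot_of_not_isRegularLocalRing hwc hwsing
  haveI : IsProper b := hb.isProper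
  haveI : IsDominant b := (hb.isBirational' hI0).isDominant
  exact ⟨ncard_excCurvePoints_lt_of_step π g h2 hπ b σ₂ hσ₂ hfac (Scheme.height_of_isClosed hwc) hgw hζw hζ,
    (finite_and_ncard_excCurvePoints_stage_le π (b ≫ g) σ₂ h2 hπ hσ₂ hfac).2⟩

end Summit.ResolutionOfSingularities.ResolutionOfSingularities.Theorems.NoZeno.QuadraticTransform

end
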